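import Summits.ValiantsHypothesis.ValiantsHypothesis.Theorems.LacunarySymmetroidMatrixDescartesCensusLaguerre
import Mathlib.Algebra.Polynomial.EraseLead
import Mathlib.Tactic.LinearCombination
import Literature.Algebra.Polynomial.DescartesSignVariations

/-!
# `MatrixDescartes` census — LAGUERRE'S RULE, part 2: the splitting lemma and the sum form `#Z₊(f) ≤ V(S) + V(U)`

HONEST FRAMING.  Object-search cell `pub-symmetroid`, route crux `Theses.LacunarySymmetroid.MatrixDescartes`
(ledger item stmt-ValiantsHypothesis-18050).  Kernel theorems about ONE arbitrary real polynomial (companion of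
`…CensusLaguerre.lean`, which has the Laguerre cofactor `h_M = Σ_{k<M} x^{M-1-k}X^k`, the root bound
`#Z₊(f) ≤ Var(f·h_M)` and the coefficient dictionary «lower partial sums / upper partial sums»).  Nothing here bears on
`ζ_sym`, on `DoorA26` / `DoorA34`, on the crux, or on `VP ≠ VNP`.

CONTENTS.
* `signVariations_eq_of_sign_coeff_eq` — `Var` depends only on the coefficient signs;
* `signVariations_add_X_pow_mul` — SPLITTING LEMMA: for `A ≠ 0` with `natDegree A < k` and `B ≠ 0` whose lowest
  non-zero coefficient is `B_t`, `Var(A + X^k·B) = Var(A) + Var(B) + [sign(lead A) = −sign(B_t)]` (induction along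
  `eraseLead` with Mathlib's `signVariations_eq_eraseLead_add_ite`);
* `signVariations_add_X_pow_mul_le` (`≤ Var A + Var B + 1`, no side conditions) and `…_of_sign_eq` (`=` at a
  matching junction) — the block-chopping corollaries used in sign-pattern bounds;
* `roots_countP_pos_le_signVariations_lower_add_upper` — **LAGUERRE'S RULE, TWO-SIDED SUM FORM**: for `x > 0` with
  `f(x) ≠ 0`, the number of positive roots of `f` (with multiplicity) is at most
  `Var(Σ_m S_m(x) X^m) + Var(Σ_k U_k(x) X^k)`, `S_m(x) = Σ_{j≤m} a_j x^j`, `U_k(x) = Σ_{k≤j≤n} a_j x^j` — i.e.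
  `V(S_0(x),…,S_n(x)) + V(U_0(x),…,U_n(x))` with zeros skipped (classically the two summands bound `Z(f;(0,x))` and
  `Z(f;(x,∞))`, Laguerre 1883; Pólya–Szegő II, Abschn. V, Kap. 1, §1).  Proof: `f·h_{n+1} = A + X^{n+1}B` with `A`
  carrying the signs of the `S_m` and `f(x) + X·B` carrying the signs of the `U_k`; the splitting lemma twice.
No `def`.  Literature-grade mathematics kept under `…Census` for the cell's kernel column (a librarian may re-home it).

[cite: PolyaSzego1925, Abschn. V Kap. 1 §1 (Laguerre)] for the rule; the splitting lemma is [folklore].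
-/

-- `Summit.ValiantsHypothesis.ValiantsHypothesis.…` repeats a component by the D-0017 layout
-- (single-conjunct summit), which the `dupNamespace` linter flags; the name is mandated.
set_option linter.dupNamespace false

namespace Summit.ValiantsHypothesis.ValiantsHypothesis.Theorems.LacunarySymmetroidMatrixDescartes.Census

open Polynomial Finset
open scoped BigOperators Polynomial

/-- Sign variations depend only on the SIGNS of the coefficients. [folklore] -/
theorem signVariations_eq_of_sign_coeff_eq {P Q : ℝ[X]}
    (h : ∀ n, SignType.sign (P.coeff n) = SignType.sign (Q.coeff n)) :
    P.signVariations = Q.signVariations := by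
  have hsupp : P.support = Q.support := by
    ext n
    rw [mem_support_iff, mem_support_iff, ← sign_ne_zero, ← sign_ne_zero (a := Q.coeff n), h n]
  have hdeg : P.degree = Q.degree := by
    rw [degree, degree, hsupp]
  unfold signVariations coeffList
  rw [hdeg, List.map_map, List.map_map]
  have : (SignType.sign ∘ P.coeff) = (SignType.sign ∘ Q.coeff) := funext h
  rw [this]

/-- `eraseLead` commutes with multiplication by `X ^ k`. [folklore] -/
theorem eraseLead_X_pow_mul' (k : ℕ) (B : ℝ[X]) : (X ^ k * B).eraseLead = X ^ k * B.eraseLead := by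
  by_cases hB : B = 0
  · simp [hB]
  ext i
  rw [coeff_X_pow_mul', eraseLead_coeff, coeff_X_pow_mul', natDegree_X_pow_mul k hB, eraseLead_coeff]
  split_ifs <;> first | rfl | (exfalso; omega)

/-- A polynomial all of whose coefficients below `natDegree` vanish is its leading monomial, so its
`eraseLead` is zero. [folklore] -/
theorem eraseLead_eq_zero_of_coeff_eq_zero_below {B : ℝ[X]} (h : ∀ m < B.natDegree, B.coeff m = 0) :
    B.eraseLead = 0 := by
  ext i
  rw [eraseLead_coeff, coeff_zero]
  split_ifs with hi
  · rfl
  · rcases lt_or_gt_of_ne hi with hlt | hgt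
    · exact h i hlt
    · exact coeff_eq_zero_of_natDegree_lt hgt

/-- **Splitting lemma for sign variations.**  If `A ≠ 0` has `natDegree A < k` and `B ≠ 0` has lowest non-zero
coefficient `B.coeff t` (all coefficients below `t` vanish), then the coefficient sequence of `A + X^k · B` is that
of `A` followed (after zeros) by that of `B`, so
`Var(A + X^k B) = Var(A) + Var(B) + [sign(lead A) = −sign(B_t)]`. [folklore] -/
theorem signVariations_add_X_pow_mul :
    ∀ (s : ℕ) (A B : ℝ[X]) (k t : ℕ), B.support.card = s → A ≠ 0 → A.natDegree < k → B ≠ 0 →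
      (∀ m < t, B.coeff m = 0) → B.coeff t ≠ 0 →
      (A + X ^ k * B).signVariations = A.signVariations + B.signVariations +
        (if SignType.sign A.leadingCoeff = -SignType.sign (B.coeff t) then 1 else 0) := by
  intro s
  induction s using Nat.strong_induction_on with
  | _ s ih =>
  intro A B k t hs hA hAk hB hlow hct
  have hXB : (X ^ k * B) ≠ 0 := mul_ne_zero (pow_ne_zero _ X_ne_zero) hB
  have hdegXB : (X ^ k * B).natDegree = B.natDegree + k := natDegree_X_pow_mul k hB
  have hlt : A.natDegree < (X ^ k * B).natDegree := by rw [hdegXB]; omega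
  have hP : A + X ^ k * B ≠ 0 := by
    intro h0
    have : X ^ k * B = -A := by linear_combination h0
    rw [this, natDegree_neg] at hlt
    exact lt_irrefl _ hlt
  have hleadP : (A + X ^ k * B).leadingCoeff = B.leadingCoeff := by
    rw [leadingCoeff_add_of_degree_lt (degree_lt_degree hlt), leadingCoeff_mul, leadingCoeff_X_pow, one_mul]
  have heraseP : (A + X ^ k * B).eraseLead = A + X ^ k * B.eraseLead := by
    rw [eraseLead_add_of_natDegree_lt_right hlt, eraseLead_X_pow_mul']
  have ht_le : t ≤ B.natDegree := le_natDegree_of_ne_zero hct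
  rw [signVariations_eq_eraseLead_add_ite hP, heraseP, hleadP]
  by_cases hB' : B.eraseLead = 0
  · -- `B` is its leading monomial: `t = natDegree B`, `B.coeff t = leadingCoeff B`
    have ht : t = B.natDegree := by
      by_contra hne
      have hlt' : t < B.natDegree := lt_of_le_of_ne ht_le hne
      have : B.eraseLead.coeff t = B.coeff t := eraseLead_coeff_of_ne t hne
      rw [hB', coeff_zero] at this
      exact hct this.symm
    have hVB : B.signVariations = 0 := by
      rw [signVariations_eq_eraseLead_add_ite hB, hB', signVariations_zero, zero_add, leadingCoeff_zero,
        sign_zero, neg_zero, if_neg (sign_ne_zero.mpr (leadingCoeff_ne_zero.mpr hB))]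
    rw [hB', mul_zero, add_zero, hVB, add_zero, ht, coeff_natDegree]
    congr 1
    by_cases h1 : SignType.sign B.leadingCoeff = -SignType.sign A.leadingCoeff
    · rw [if_pos h1, if_pos]; rw [h1, neg_neg]
    · rw [if_neg h1, if_neg]; intro h2; apply h1; rw [h2, neg_neg]
  · -- induction on `B.eraseLead`
    have hcard : B.eraseLead.support.card < s := hs ▸ eraseLead_support_card_lt hB
    have htne : t ≠ B.natDegree := by
      intro hteq
      apply hB'
      apply eraseLead_eq_zero_of_coeff_eq_zero_below
      intro m hm; exact hlow m (hteq ▸ hm)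
    have hlow' : ∀ m < t, B.eraseLead.coeff m = 0 := by
      intro m hm
      rw [eraseLead_coeff_of_ne m (by omega)]
      exact hlow m hm
    have hct' : B.eraseLead.coeff t ≠ 0 := by
      rw [eraseLead_coeff_of_ne t htne]; exact hct
    have hIH := ih _ hcard A B.eraseLead k t rfl hA hAk hB' hlow' hct'
    rw [eraseLead_coeff_of_ne t htne] at hIH
    rw [hIH]
    have hVB : B.signVariations = B.eraseLead.signVariations +
        (if SignType.sign B.leadingCoeff = -SignType.sign B.eraseLead.leadingCoeff then 1 else 0) :=
      signVariations_eq_eraseLead_add_ite hB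
    -- leading coefficient of `A + X^k B.eraseLead` is that of `B.eraseLead`
    have hlt2 : A.natDegree < (X ^ k * B.eraseLead).natDegree := by
      rw [natDegree_X_pow_mul k hB']; omega
    have hlead2 : (A + X ^ k * B.eraseLead).leadingCoeff = B.eraseLead.leadingCoeff := by
      rw [leadingCoeff_add_of_degree_lt (degree_lt_degree hlt2), leadingCoeff_mul, leadingCoeff_X_pow, one_mul]
    rw [hlead2, hVB]
    ring


/-- **Splitting inequality** (no side conditions): `Var(A + X^k·B) ≤ Var(A) + Var(B) + 1` whenever
`natDegree A < k` — the block-chopping tool for bounding `Var` of a coefficient sequence with sign information given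
block by block (a block of one weak sign has `Var = 0`: `Literature…Descartes.signVariations_eq_zero_of_coeff_nonneg /
_nonpos`). [folklore] -/
theorem signVariations_add_X_pow_mul_le (A B : ℝ[X]) {k : ℕ} (hAk : A.natDegree < k) :
    (A + X ^ k * B).signVariations ≤ A.signVariations + B.signVariations + 1 := by
  by_cases hA : A = 0
  · rw [hA, zero_add, Literature.Algebra.Polynomial.Descartes.signVariations_X_pow_mul]; omega
  by_cases hB : B = 0
  · rw [hB, mul_zero, add_zero]; omega
  have hct : B.coeff B.natTrailingDegree ≠ 0 := by
    change B.trailingCoeff ≠ 0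
    exact fun h => hB (trailingCoeff_eq_zero.mp h)
  rw [signVariations_add_X_pow_mul _ A B k B.natTrailingDegree rfl hA hAk hB
    (fun m hm => coeff_eq_zero_of_lt_natTrailingDegree hm) hct]
  split_ifs <;> omega

/-- **Splitting equality at a matching junction**: if moreover `A ≠ 0`, `B ≠ 0` and the leading coefficient of `A`
has the SAME sign as the lowest non-zero coefficient of `B`, then `Var(A + X^k·B) = Var(A) + Var(B)`. [folklore] -/
theorem signVariations_add_X_pow_mul_of_sign_eq (A B : ℝ[X]) {k : ℕ} (hAk : A.natDegree < k) (hA : A ≠ 0)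
    (hB : B ≠ 0) (hsame : SignType.sign A.leadingCoeff = SignType.sign B.trailingCoeff) :
    (A + X ^ k * B).signVariations = A.signVariations + B.signVariations := by
  have hct : B.coeff B.natTrailingDegree ≠ 0 := by
    change B.trailingCoeff ≠ 0
    exact fun h => hB (trailingCoeff_eq_zero.mp h)
  rw [signVariations_add_X_pow_mul _ A B k B.natTrailingDegree rfl hA hAk hB
    (fun m hm => coeff_eq_zero_of_lt_natTrailingDegree hm) hct, if_neg, add_zero]
  change ¬ SignType.sign A.leadingCoeff = -SignType.sign B.trailingCoeff
  rw [hsame]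
  intro h
  have hs : SignType.sign B.trailingCoeff ≠ 0 := sign_ne_zero.mpr (fun h' => hB (trailingCoeff_eq_zero.mp h'))
  rcases hc : SignType.sign B.trailingCoeff with _ | _ | _ <;> rw [hc] at h hs <;> first | exact hs rfl | exact absurd h (by decide)

/-! ### Truncated coefficient polynomials and the two-sided sum form `Z₊(f) ≤ V(S) + V(U)` -/

/-- Coefficients of an explicit finite sum `Σ_{m<N} C(c m)·X^m`. [folklore] -/
theorem coeff_sum_C_mul_X_pow (c : ℕ → ℝ) (N i : ℕ) :
    (∑ m ∈ range N, C (c m) * X ^ m : ℝ[X]).coeff i = if i < N then c i else 0 := by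
  rw [finsetSum_coeff]
  simp_rw [coeff_C_mul, coeff_X_pow]
  split_ifs with hi
  · rw [Finset.sum_eq_single i]
    · simp
    · intro k _ hk; simp [Ne.symm hk]
    · intro hi'; exact absurd (mem_range.mpr hi) hi'
  · apply Finset.sum_eq_zero
    intro k hk
    have : i ≠ k := by intro e; subst e; exact hi (mem_range.mp hk)
    simp [this]

/-- Multiplying by a positive number does not change the sign. [folklore] -/
theorem sign_mul_of_pos {a : ℝ} (ha : 0 < a) (b : ℝ) : SignType.sign (a * b) = SignType.sign b := by
  rw [sign_mul, sign_pos ha, one_mul]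

/-- **LAGUERRE'S RULE, TWO-SIDED SUM FORM.**  Let `f ∈ ℝ[X]` have degree `n`, let `x > 0` with `f(x) ≠ 0`, and let
`S_m(x) = Σ_{j ≤ m} a_j x^j` (`m = 0..n`, lower partial sums) and `U_k(x) = Σ_{k ≤ j ≤ n} a_j x^j` (`k = 0..n`, upper
partial sums).  Then the number of positive roots of `f`, counted with multiplicity, is at most
`V(S_0(x),…,S_n(x)) + V(U_0(x),…,U_n(x))` — here written with the two «sign carrier» polynomials `Σ_m S_m(x) X^m` and
`Σ_k U_k(x) X^k`, whose Mathlib `signVariations` are exactly those two counts (zeros skipped).  Classically the two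
summands bound `Z(f;(0,x))` and `Z(f;(x,∞))` separately (Laguerre 1883); the sum is what the cell's end-kill theorems
use, and it follows from Descartes' rule for `f · Σ_{k≤n} x^{n-k}X^k` plus the splitting lemma
`signVariations_add_X_pow_mul`. [cite: PolyaSzego1925, Abschn. V Kap. 1 §1 (Laguerre)] -/
theorem roots_countP_pos_le_signVariations_lower_add_upper (f : ℝ[X]) {x : ℝ} (hx : 0 < x)
    (hfx : f.eval x ≠ 0) :
    f.roots.countP (fun t => 0 < t) ≤
      (∑ m ∈ range (f.natDegree + 1), C (∑ j ∈ range (m + 1), f.coeff j * x ^ j) * X ^ m : ℝ[X]).signVariations +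
      (∑ k ∈ range (f.natDegree + 1), C (∑ j ∈ Icc k f.natDegree, f.coeff j * x ^ j) * X ^ k : ℝ[X]).signVariations := by
  -- notation
  set n := f.natDegree with hn
  set g : ℝ[X] := f * ∑ k ∈ range (n + 1), C (x ^ (n + 1 - 1 - k)) * X ^ k with hg
  set S : ℕ → ℝ := fun m => ∑ j ∈ range (m + 1), f.coeff j * x ^ j with hS
  set U : ℕ → ℝ := fun k => ∑ j ∈ Icc k n, f.coeff j * x ^ j with hU
  obtain ⟨hroots, hlow, hup, hzero⟩ := laguerre_partial_sums f hx
  -- `S n = f x = U 0`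
  have hSn : S n = f.eval x := by simp only [hS]; rw [eval_eq_sum_range]
  have hU0 : U 0 = f.eval x := by
    simp only [hU]; rw [eval_eq_sum_range]
    apply Finset.sum_congr _ (fun _ _ => rfl)
    ext j; simp only [mem_Icc, mem_range]; omega
  -- the truncations `A` (degrees ≤ n) and `B` (degrees n+1 … 2n, shifted down)
  set A : ℝ[X] := ∑ m ∈ range (n + 1), C (g.coeff m) * X ^ m with hA
  set B : ℝ[X] := ∑ k ∈ range n, C (g.coeff (n + 1 + k)) * X ^ k with hB
  have hAc : ∀ i, A.coeff i = if i < n + 1 then g.coeff i else 0 := fun i => coeff_sum_C_mul_X_pow _ _ i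
  have hBc : ∀ i, B.coeff i = if i < n then g.coeff (n + 1 + i) else 0 := fun i => coeff_sum_C_mul_X_pow _ _ i
  have hgAB : g = A + X ^ (n + 1) * B := by
    ext i
    rw [coeff_add, coeff_X_pow_mul', hAc, hBc]
    by_cases h1 : i < n + 1
    · rw [if_pos h1, if_neg (by omega), add_zero]
    · rw [if_neg h1, zero_add, if_pos (by omega)]
      by_cases h2 : i - (n + 1) < n
      · rw [if_pos h2]; congr 1; omega
      · rw [if_neg h2]; exact hzero i (by omega)
  -- signs of `A` are the signs of the lower sums
  have hSc : ∀ i, (∑ m ∈ range (n + 1), C (S m) * X ^ m : ℝ[X]).coeff i = if i < n + 1 then S i else 0 :=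
    fun i => coeff_sum_C_mul_X_pow S (n + 1) i
  have hsignA : ∀ i, SignType.sign (A.coeff i) =
      SignType.sign ((∑ m ∈ range (n + 1), C (S m) * X ^ m : ℝ[X]).coeff i) := by
    intro i
    rw [hSc, hAc]
    by_cases h1 : i < n + 1
    · rw [if_pos h1, if_pos h1, hlow i (by omega), sign_mul_of_pos (pow_pos hx _)]
    · rw [if_neg h1, if_neg h1]
  have hVA : A.signVariations = (∑ m ∈ range (n + 1), C (S m) * X ^ m : ℝ[X]).signVariations :=
    signVariations_eq_of_sign_coeff_eq hsignA
  have hAn : A.coeff n = f.eval x := by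
    rw [hAc, if_pos (Nat.lt_succ_self n), hlow n le_rfl, Nat.sub_self, pow_zero, one_mul]; exact hSn
  have hA0 : A ≠ 0 := by
    intro h0; apply hfx; rw [← hAn, h0, coeff_zero]
  have hdegA_le : A.natDegree ≤ n := by
    rw [natDegree_le_iff_coeff_eq_zero]
    intro N hN; rw [hAc, if_neg (by omega)]
  have hdegA : A.natDegree = n :=
    natDegree_eq_of_le_of_coeff_ne_zero hdegA_le (by rw [hAn]; exact hfx)
  have hleadA : A.leadingCoeff = f.eval x := by rw [leadingCoeff, hdegA, hAn]
  -- the «B⁺» polynomial `f(x) + X · B` carries the signs of the upper sums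
  set Bp : ℝ[X] := C (f.eval x) + X ^ 1 * B with hBp
  have hBpc : ∀ k, Bp.coeff k = if k = 0 then f.eval x else B.coeff (k - 1) := by
    intro k
    rw [hBp, coeff_add, coeff_C, coeff_X_pow_mul']
    by_cases hk : k = 0
    · subst hk; simp
    · rw [if_neg hk, if_pos (by omega), if_neg hk, zero_add]
  have hUc : ∀ i, (∑ k ∈ range (n + 1), C (U k) * X ^ k : ℝ[X]).coeff i = if i < n + 1 then U i else 0 :=
    fun i => coeff_sum_C_mul_X_pow U (n + 1) i
  have hsignBp : ∀ k, SignType.sign (Bp.coeff k) =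
      SignType.sign ((∑ k ∈ range (n + 1), C (U k) * X ^ k : ℝ[X]).coeff k) := by
    intro k
    rw [hUc, hBpc]
    by_cases hk : k = 0
    · subst hk; rw [if_pos rfl, if_pos (Nat.succ_pos n), hU0]
    · rw [if_neg hk, hBc]
      by_cases hk2 : k - 1 < n
      · rw [if_pos hk2, if_pos (by omega)]
        have e1 : n + 1 + (k - 1) = n + k := by omega
        have hupk := hup (n + k) (by omega)
        have e2 : n + k - n = k := by omega
        rw [e2] at hupk
        rw [e1, ← sign_mul_of_pos (pow_pos hx k), hupk]
      · rw [if_neg hk2]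
        by_cases hk3 : k < n + 1
        · -- then k = n + ... impossible unless k - 1 ≥ n and k ≤ n: k = n? k-1 < n fails means k ≥ n+1
          exfalso; omega
        · rw [if_neg hk3]
  have hVBp : Bp.signVariations = (∑ k ∈ range (n + 1), C (U k) * X ^ k : ℝ[X]).signVariations :=
    signVariations_eq_of_sign_coeff_eq hsignBp
  -- assemble
  rw [← hVA, ← hVBp]
  have hroots' : f.roots.countP (fun t => 0 < t) ≤ g.signVariations := hroots
  refine hroots'.trans ?_
  rw [hgAB]
  by_cases hB0 : B = 0
  · rw [hB0, mul_zero, add_zero]; exact Nat.le_add_right _ _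
  · -- lowest non-zero coefficient of `B`
    set t := B.natTrailingDegree with ht
    have hlowB : ∀ m < t, B.coeff m = 0 := fun m hm => coeff_eq_zero_of_lt_natTrailingDegree hm
    have hct : B.coeff t ≠ 0 := by
      change B.trailingCoeff ≠ 0
      exact fun h => hB0 (trailingCoeff_eq_zero.mp h)
    have h1 := signVariations_add_X_pow_mul _ A B (n + 1) t rfl hA0 (by omega) hB0 hlowB hct
    have hC0 : (C (f.eval x) : ℝ[X]) ≠ 0 := by rwa [Ne, C_eq_zero]
    have h2 := signVariations_add_X_pow_mul _ (C (f.eval x)) B 1 t rfl hC0 (by rw [natDegree_C]; omega)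
      hB0 hlowB hct
    have hVC : (C (f.eval x) : ℝ[X]).signVariations = 0 := by
      rw [← monomial_zero_left]; exact signVariations_monomial 0 _
    rw [h1, hBp, h2, hleadA, leadingCoeff_C, hVC]
    omega


/-! ### Appended (engine-6 g16, 2026-08-25): BLOCK BOUND for `signVariations` + indicator partial sums (= the content of the
separately filed `…CensusSignBlocks.lean`, folded in so that `…CensusLaguerreL18.lean` depends on built modules only) -/
/-- One weak sign `ε ∈ {1, −1}` on all coefficients ⇒ no sign variation. [folklore] -/
theorem signVariations_eq_zero_of_weakSign {P : ℝ[X]} {ε : ℝ} (hε : ε = 1 ∨ ε = -1)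
    (h : ∀ m, 0 ≤ ε * P.coeff m) : P.signVariations = 0 := by
  rcases hε with rfl | rfl
  · exact Literature.Algebra.Polynomial.Descartes.signVariations_eq_zero_of_coeff_nonneg (fun n => by simpa using h n)
  · exact Literature.Algebra.Polynomial.Descartes.signVariations_eq_zero_of_coeff_nonpos (fun n => by have := h n; linarith)
/-- **Block bound.**  If the indices `0 … natDegree P` are covered by `r` consecutive blocks `[c i, c (i+1))` (`c 0 = 0`,
`c` monotone, `natDegree P < c r`), each weakly one-signed, then `Var(P) + 1 ≤ r`. [folklore] -/
theorem signVariations_succ_le_of_blocks :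
    ∀ (r : ℕ) (P : ℝ[X]) (c : ℕ → ℕ), c 0 = 0 → Monotone c → P.natDegree < c r →
      (∀ i < r, ∃ ε : ℝ, (ε = 1 ∨ ε = -1) ∧ ∀ m, c i ≤ m → m < c (i + 1) → 0 ≤ ε * P.coeff m) →
      P.signVariations + 1 ≤ r := by
  intro r
  induction r with
  | zero => intro P c hc0 _ hdeg; rw [hc0] at hdeg; exact absurd hdeg (Nat.not_lt_zero _)
  | succ r ih =>
    intro P c hc0 hmono hdeg hblocks
    set k := c r with hk
    set A : ℝ[X] := ∑ m ∈ range k, C (P.coeff m) * X ^ m with hA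
    set B : ℝ[X] := ∑ m ∈ range (P.natDegree + 1), C (P.coeff (k + m)) * X ^ m with hB
    have hAc : ∀ i, A.coeff i = if i < k then P.coeff i else 0 := fun i => coeff_sum_C_mul_X_pow _ _ i
    have hBc : ∀ i, B.coeff i = if i < P.natDegree + 1 then P.coeff (k + i) else 0 :=
      fun i => coeff_sum_C_mul_X_pow _ _ i
    have hPAB : P = A + X ^ k * B := by
      ext i
      rw [coeff_add, coeff_X_pow_mul', hAc, hBc]
      by_cases h1 : i < k
      · rw [if_pos h1, if_neg (by omega), add_zero]
      · rw [if_neg h1, zero_add, if_pos (by omega)]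
        by_cases h2 : i - k < P.natDegree + 1
        · rw [if_pos h2]; congr 1; omega
        · rw [if_neg h2]; exact coeff_eq_zero_of_natDegree_lt (by omega)
    obtain ⟨ε, hε, hεB⟩ := hblocks r (Nat.lt_succ_self r)
    have hVB : B.signVariations = 0 := by
      apply signVariations_eq_zero_of_weakSign hε
      intro m; rw [hBc]
      split_ifs with hm
      · by_cases hkm : k + m < c (r + 1)
        · exact hεB (k + m) (by omega) hkm
        · rw [coeff_eq_zero_of_natDegree_lt (by omega), mul_zero]
      · rw [mul_zero]
    by_cases hA0 : A = 0
    · rw [hPAB, hA0, zero_add, Literature.Algebra.Polynomial.Descartes.signVariations_X_pow_mul, hVB]; omega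
    have hk1 : 0 < k := by
      by_contra h0
      apply hA0
      rw [hA, show k = 0 by omega, Finset.range_zero, Finset.sum_empty]
    have hdegA : A.natDegree < k := by
      have hle : A.natDegree ≤ k - 1 := by
        rw [natDegree_le_iff_coeff_eq_zero]; intro N hN; rw [hAc, if_neg (by omega)]
      omega
    have hVA : A.signVariations + 1 ≤ r := by
      apply ih A c hc0 hmono hdegA
      intro i hi
      obtain ⟨ε', hε', hε'P⟩ := hblocks i (Nat.lt_succ_of_lt hi)
      refine ⟨ε', hε', fun m hm1 hm2 => ?_⟩
      have hmk : m < k := lt_of_lt_of_le hm2 (hmono (Nat.succ_le_of_lt hi))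
      rw [hAc, if_pos hmk]
      exact hε'P m hm1 hm2
    have hsplit := signVariations_add_X_pow_mul_le A B hdegA
    rw [← hPAB, hVB] at hsplit
    omega
/-- Indicator sums: `Σ_{j ≤ m} [j = d]·u·ρ^j = [d ≤ m]·u·ρ^d`. [folklore] -/
theorem sum_range_succ_ite_eq_mul_pow (u ρ : ℝ) (d m : ℕ) :
    ∑ j ∈ range (m + 1), (if j = d then u else 0) * ρ ^ j = if d ≤ m then u * ρ ^ d else 0 := by
  have : ∀ j ∈ range (m + 1), (if j = d then u else 0) * ρ ^ j = if d = j then u * ρ ^ d else 0 := by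
    intro j _; by_cases h : j = d
    · subst h; simp
    · rw [if_neg h, if_neg (Ne.symm h), zero_mul]
  rw [Finset.sum_congr rfl this, Finset.sum_ite_eq]
  simp only [mem_range, Nat.lt_succ_iff]
/-- Indicator sums over a window: `Σ_{k ≤ j ≤ n} [j = d]·u·ρ^j = [k ≤ d]·u·ρ^d` for `d ≤ n`. [folklore] -/
theorem sum_Icc_ite_eq_mul_pow (u ρ : ℝ) {d n : ℕ} (hdn : d ≤ n) (k : ℕ) :
    ∑ j ∈ Icc k n, (if j = d then u else 0) * ρ ^ j = if k ≤ d then u * ρ ^ d else 0 := by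
  have : ∀ j ∈ Icc k n, (if j = d then u else 0) * ρ ^ j = if d = j then u * ρ ^ d else 0 := by
    intro j _; by_cases h : j = d
    · subst h; simp
    · rw [if_neg h, if_neg (Ne.symm h), zero_mul]
  rw [Finset.sum_congr rfl this, Finset.sum_ite_eq]
  simp only [mem_Icc, hdn, and_true]

end Summit.ValiantsHypothesis.ValiantsHypothesis.Theorems.LacunarySymmetroidMatrixDescartes.Census
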